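import Summits.QuantumFields.YangMills.Theorems.UnitScaleTiltFluctuationComparisonRegPrIntLOneSupplierDisplayV4
import Summits.QuantumFields.YangMills.Theorems.UnitScaleTiltMinimiserStabilityRegPrPV3D
import Summits.QuantumFields.YangMills.Theorems.UnitScaleTiltFluctuationComparisonRegPrIntLOneSupplierV8Leaves4
import HarnessLib

/-!
# `UnitScaleTiltFluctuationComparisonRegPrIntLOneSupplierV8Leaves4V4` — THE v4 TWIN (★★OWNER RULING g26-№14 (F-2b); P22b, width seat ym-ust-20520-w2 g4; skeleton v5kD; record-free decls imported from `…IntLOneSupplierV8Leaves4`) of `…IntLOneSupplierV8Leaves4` — T8 AND THE DECIDING CRUX FROM 19200 v8's FOUR STILL-OPEN LEAVES (P-V3-D DISCHARGED BY NAME), THE χ-RECORD, AND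
# ONE BLOCK-SIZE-UNIFORM K1a PREDICATE (crux stmt-QuantumFields-20520, skeleton v5kC; lane B seat ym-ust-19935-r1 g5; companion of `…IntLOneSupplier` p588274 / `…Display` p589437)

`BirthV8.stub_PV3D` was closed by name 38 minutes after v8's registration (ym-ust-19200-w2 g0, p589019 `Summit.QuantumFields.YangMills.Theorems.PV3D.stub_PV3D`, registered text VERBATIM,
`O₂ = 178`, `c = ¼`; OWNER g24 RECORD 2026-08-28T00:21Z).  This file feeds that theorem into ★r1 g5's `thm1In8GlobalMin_of_v8Leaves` so that the by-name statement of what 20520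
still needs names only OPEN leaves:

* **`thm1In8GlobalMin_of_v8Leaves4`** : ⟨stub_halvingStep⟩ → ⟨stub_PV3A⟩ → ⟨stub_PV3C⟩ → ⟨stub_PV3E⟩ → ⟨T8 TEXT⟩;
* **`regPrIntL_of_v8Leaves4_recChiV4_k1aLegRowsRChiV4_allL`** / **`…_k1aLegRowsDisplayChi_allL`** : the four open v8 leaves → 2′χ → ONE `L`-uniform K1a predicate (leg rows
  `K1aLegRowsRChiV4`, resp. ym-ust-20520-w1's seven-row per-run display obligation `K1aLegRowsDisplayChiV4`) at every odd `L > 1` → `FluctuationComparisonRegPrIntL`.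
HONEST FRAMING: composition of landed theorems; the hypotheses ARE the analytic content and none is asserted; registry untouched (`--supports stmt-QuantumFields-20520`); YM₃ on T³ is a
rung, not the Clay problem / a gap.

References: T. Bałaban, CMP 102 (1985) 277–309 [Balaban1985Variational] (Thm 1 (8) p.279, Prop. 2 p.281, Props 5–6 pp.294–295, Prop. 7 p.299, (141)–(142) p.299, Prop. 8 p.304);
CMP 102 (1985) 255–275 [Balaban1985UV3] ((41) p.266, (43)–(47) pp.266–267, (57) p.270, Thm 2 p.272); C. King, CMP 102 (1986) 649–677 [King1986] (Thm 3.4 (3.9) p.656, Prop. 3.6 (3.56)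
p.662, Prop. 3.9 (3.73)–(3.75) p.665).
-/

set_option autoImplicit false

noncomputable section

namespace Summit.QuantumFields.YangMills.Theorems.InteriorExcision

open Literature.MathematicalPhysics.QuantumFieldTheory.Balaban1983to89
open Literature.MathematicalPhysics.QuantumFieldTheory.Balaban1983to89.T3ContinuumYM3Torus
open Literature.MathematicalPhysics.QuantumFieldTheory.Balaban1983to89.T3UnitLawDensityEML (ℰp)
open Literature.MathematicalPhysics.QuantumFieldTheory.Balaban1983to89.T3InteriorExcision
open Literature.MathematicalPhysics.QuantumFieldTheory.Balaban1983to89.T3PrintedRegularMinimiser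
open Literature.MathematicalPhysics.QuantumFieldTheory.Balaban1983to89.T3PrintedMinimiserExistence
open Literature.MathematicalPhysics.QuantumFieldTheory.Balaban1983to89.T3ConstrainedMinimiser (fibre)
open Literature.MathematicalPhysics.QuantumFieldTheory.Balaban1983to89.T3LowerAlongMinimisersSplit (MinimisersIn8At)
open Literature.MathematicalPhysics.QuantumFieldTheory.Balaban1983to89.T3Thm1Carrier (famX Idx)
open Literature.MathematicalPhysics.QuantumFieldTheory.Balaban1983to89.T3Thm1CarrierNative (IsCritR2)
open Literature.MathematicalPhysics.QuantumFieldTheory.Balaban1983to89.T3SectALandauChart (ResidFam famLG3 In19 CloseAvg emb15)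
open Literature.MathematicalPhysics.QuantumFieldTheory.Balaban1983to89.B11 (Prop2Printed)
open Summit.QuantumFields.Balaban3D.Carriers
open Summit.QuantumFields.Balaban3D.Proofs.Primitives
open Summit.QuantumFields.YangMills.Theorems.Prop7TPrint (nMax19 expHermField)
open Summit.QuantumFields.YangMills.Theorems.Prop7SPrint (sPrint RestrictedPrint AvgCondPrint IsLandauPrint CritLPrint)
open Summit.QuantumFields.YangMills.Theorems.GlobalSlackKernelLeg (K1aLegRowsRChiV4 K1aLegRowsDisplayChiV4)

-- (record-free `thm1In8GlobalMin_of_v8Leaves4`: imported from the v3 module, not restated)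

/-- **THE DECIDING CRUX FROM v8's FOUR OPEN LEAVES, THE χ-RECORD AND THE `L`-UNIFORM LEG PREDICATE** (`regPrIntL_of_v8Leaves_recChiV4_k1aLegRowsRChiV4_allL` with P-V3-D discharged by
`PV3D.stub_PV3D`). [cite: Balaban1985UV3, (41) p.266, (43)-(47) pp.266-267, (57) p.270, Thm 2 p.272; Balaban1985Variational, Thm 1 (8) p.279, Prop. 7 p.299, Prop. 8 p.304; King1986, Thm 3.4 (3.9) p.656, Prop. 3.6 (3.56) p.662] -/
theorem regPrIntL_of_v8Leaves4_recChiV4_k1aLegRowsRChiV4_allL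
    (hV2 : ∀ (L : ℕ), 1 < L → ∃ B₃ : ℝ, 4 < B₃ ∧ ∃ a₅ : ℝ, 0 < a₅ ∧
      ∀ (i : Idx L) (ε₀ ε₁ : ℝ), 0 < ε₁ → ∀ (V : (famX L i).Bdry) (U : (famX L i).Cfg), (famX L i).Reg7 ε₁ V → (famX L i).InU ε₀ U →
        (famX L i).InB V U → (famX L i).IsCritical V U → ε₀ ≤ a₅ → (famX L i).InU (max (B₃ * ε₁) (ε₀ / 2)) U)
    (hA : ∀ (L : ℕ), 1 < L → ∀ (T : ResidFam L) (B₃ : ℝ), 4 < B₃ →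
      ∃ B₁ c₁ : ℝ, 0 < B₁ ∧ 0 < c₁ ∧ Prop2Printed B₁ B₃ ((L : ℝ) ^ 3) c₁ (famLG3 L (sPrint L T)))
    (hC : ∀ (L : ℕ), 1 < L → ∀ (B₃ : ℝ), 4 < B₃ →
      ∃ B₀ a₄ : ℝ, 0 < B₀ ∧ 0 < a₄ ∧ ∀ (i : Idx L) (ε₁ ε₄ : ℝ), 0 < ε₁ → ε₄ ≤ a₄ → 2 * B₀ * (L : ℝ) ^ 3 * B₃ * ε₁ ≤ ε₄ →
        ∀ (V : GaugeField (i.1.1.P i.1.2.1) 0 (Matrix.specialUnitaryGroup (Fin 2) ℂ))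
          (U₀ : GaugeField (i.1.1.P i.1.2.2) 0 (Matrix.specialUnitaryGroup (Fin 2) ℂ)),
          RegPr i.1.1 i.1.2.1 i.1.2.2 ((L : ℝ) ^ 3 * B₃ * ε₁) U₀ → CloseAvg i.1.1 i.1.2.1 i.1.2.2 i.2.2.le ((L : ℝ) ^ 3 * ε₁) V U₀ →
          ∃ X : PBond (i.1.1.P i.1.2.2) 0 → Matrix (Fin 2) (Fin 2) ℂ,
            nMax19 i.1.1 i.1.2.1 i.1.2.2 U₀ X < ε₄ ∧
            ((∀ b : PBond (i.1.1.P i.1.2.2) 0, (X b).IsHermitian ∧ Matrix.trace (X b) = 0) ∧ AvgCondPrint i.1.1 i.1.2.1 i.1.2.2 i.2.2.le V U₀ X ∧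
              IsLandauPrint i.1.1 i.1.2.1 i.1.2.2 U₀ X ∧ CritLPrint i.1.1 i.1.2.1 i.1.2.2 i.2.2.le V U₀ (expHermField X)) ∧
            nMax19 i.1.1 i.1.2.1 i.1.2.2 U₀ X < 3 * B₀ * (L : ℝ) ^ 3 * B₃ * ε₁ ∧
            ∀ X' : PBond (i.1.1.P i.1.2.2) 0 → Matrix (Fin 2) (Fin 2) ℂ, nMax19 i.1.1 i.1.2.1 i.1.2.2 U₀ X' < ε₄ →
              ((∀ b : PBond (i.1.1.P i.1.2.2) 0, (X' b).IsHermitian ∧ Matrix.trace (X' b) = 0) ∧ AvgCondPrint i.1.1 i.1.2.1 i.1.2.2 i.2.2.le V U₀ X' ∧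
                IsLandauPrint i.1.1 i.1.2.1 i.1.2.2 U₀ X' ∧ CritLPrint i.1.1 i.1.2.1 i.1.2.2 i.2.2.le V U₀ (expHermField X')) → X' = X)
    (hE : ∀ (L : ℕ), 1 < L → ∀ (B₃ : ℝ), 4 < B₃ →
      ∃ e₅ : ℝ, 0 < e₅ ∧ ∀ (i : Idx L) (e ε₁ : ℝ) (V : GaugeField (i.1.1.P i.1.2.1) 0 (Matrix.specialUnitaryGroup (Fin 2) ℂ))
        (U₀ U₁ : GaugeField (i.1.1.P i.1.2.2) 0 (Matrix.specialUnitaryGroup (Fin 2) ℂ)) (u : GaugeTransf (i.1.1.P i.1.2.2) 0 (Matrix.specialUnitaryGroup (Fin 2) ℂ)),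
        e ≤ e₅ → RegPr i.1.1 i.1.2.1 i.1.2.2 ((L : ℝ) ^ 3 * B₃ * ε₁) U₀ → CloseAvg i.1.1 i.1.2.1 i.1.2.2 i.2.2.le ((L : ℝ) ^ 3 * ε₁) V U₀ →
        CritLPrint i.1.1 i.1.2.1 i.1.2.2 i.2.2.le V U₀ U₁ → RestrictedPrint i.1.1 i.1.2.1 i.1.2.2 U₀ u →
        RegPr i.1.1 i.1.2.1 i.1.2.2 e (GaugeField.gaugeAct u (emb15 U₀ U₁)) →
        GaugeField.gaugeAct u (emb15 U₀ U₁) ∈ fibre i.1.1 ℰp i.1.2.1 i.1.2.2 i.2.2.le V →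
        IsCritR2 i.1.1 i.1.2.1 i.1.2.2 i.2.2.le V (GaugeField.gaugeAct u (emb15 U₀ U₁)) →
          GaugeField.gaugeAct u (emb15 U₀ U₁) ∈ regFibrePr i.1.1 i.1.2.1 i.1.2.2 i.2.2.le e V ∧
          IsMinOn (fun W : GaugeField (i.1.1.P i.1.2.2) 0 (Matrix.specialUnitaryGroup (Fin 2) ℂ) => wilsonAction4 W)
            (regFibrePr i.1.1 i.1.2.1 i.1.2.2 i.2.2.le e V) (GaugeField.gaugeAct u (emb15 U₀ U₁)))
    (h2 : ∀ L : ℕ, Odd L → 1 < L → Summit.QuantumFields.YangMills.Theorems.AlphaInputsT3ACv4RecChi L)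
    (hK : ∀ (L : ℕ), Odd L → 1 < L → ∀ (𝔠 : AlphaConsts L (suGroupModel 2).N) (a₀ a₁ : ℝ), 0 < a₀ → 0 < a₁ → 𝔠.B₃ * a₁ ≤ a₀ →
      ∃ a : ℝ, 0 < a ∧ a < 1 ∧ K1aLegRowsRChiV4 L 𝔠 a₀ a₁ a) :
    FluctuationComparisonRegPrIntL :=
  regPrIntL_of_v8Leaves_recChiV4_k1aLegRowsRChiV4_allL hV2 hA hC Summit.QuantumFields.YangMills.Theorems.PV3D.stub_PV3D hE h2 hK

/-- **THE DECIDING CRUX FROM v8's FOUR OPEN LEAVES, THE χ-RECORD AND ym-ust-20520-w1's PER-RUN DISPLAY OBLIGATION AT EVERY ODD BLOCK SIZE**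
(`regPrIntL_of_v8Leaves_recChiV4_k1aLegRowsDisplayChiV4_allL` with P-V3-D discharged by `PV3D.stub_PV3D`). [cite: Balaban1985UV3, (25) p.262, (43)-(47) pp.266-267, (57) p.270, (61)-(63) pp.271-272, Thm 2 p.272; Balaban1985Variational, Thm 1 (8) p.279, Prop. 7 p.299, Prop. 8 p.304; King1986, Thm 3.4 (3.9) p.656, Prop. 3.6 (3.56) p.662, Prop. 3.9 (3.73)-(3.75) p.665] -/
theorem regPrIntL_of_v8Leaves4_recChiV4_k1aLegRowsDisplayChiV4_allL
    (hV2 : ∀ (L : ℕ), 1 < L → ∃ B₃ : ℝ, 4 < B₃ ∧ ∃ a₅ : ℝ, 0 < a₅ ∧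
      ∀ (i : Idx L) (ε₀ ε₁ : ℝ), 0 < ε₁ → ∀ (V : (famX L i).Bdry) (U : (famX L i).Cfg), (famX L i).Reg7 ε₁ V → (famX L i).InU ε₀ U →
        (famX L i).InB V U → (famX L i).IsCritical V U → ε₀ ≤ a₅ → (famX L i).InU (max (B₃ * ε₁) (ε₀ / 2)) U)
    (hA : ∀ (L : ℕ), 1 < L → ∀ (T : ResidFam L) (B₃ : ℝ), 4 < B₃ →
      ∃ B₁ c₁ : ℝ, 0 < B₁ ∧ 0 < c₁ ∧ Prop2Printed B₁ B₃ ((L : ℝ) ^ 3) c₁ (famLG3 L (sPrint L T)))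
    (hC : ∀ (L : ℕ), 1 < L → ∀ (B₃ : ℝ), 4 < B₃ →
      ∃ B₀ a₄ : ℝ, 0 < B₀ ∧ 0 < a₄ ∧ ∀ (i : Idx L) (ε₁ ε₄ : ℝ), 0 < ε₁ → ε₄ ≤ a₄ → 2 * B₀ * (L : ℝ) ^ 3 * B₃ * ε₁ ≤ ε₄ →
        ∀ (V : GaugeField (i.1.1.P i.1.2.1) 0 (Matrix.specialUnitaryGroup (Fin 2) ℂ))
          (U₀ : GaugeField (i.1.1.P i.1.2.2) 0 (Matrix.specialUnitaryGroup (Fin 2) ℂ)),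
          RegPr i.1.1 i.1.2.1 i.1.2.2 ((L : ℝ) ^ 3 * B₃ * ε₁) U₀ → CloseAvg i.1.1 i.1.2.1 i.1.2.2 i.2.2.le ((L : ℝ) ^ 3 * ε₁) V U₀ →
          ∃ X : PBond (i.1.1.P i.1.2.2) 0 → Matrix (Fin 2) (Fin 2) ℂ,
            nMax19 i.1.1 i.1.2.1 i.1.2.2 U₀ X < ε₄ ∧
            ((∀ b : PBond (i.1.1.P i.1.2.2) 0, (X b).IsHermitian ∧ Matrix.trace (X b) = 0) ∧ AvgCondPrint i.1.1 i.1.2.1 i.1.2.2 i.2.2.le V U₀ X ∧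
              IsLandauPrint i.1.1 i.1.2.1 i.1.2.2 U₀ X ∧ CritLPrint i.1.1 i.1.2.1 i.1.2.2 i.2.2.le V U₀ (expHermField X)) ∧
            nMax19 i.1.1 i.1.2.1 i.1.2.2 U₀ X < 3 * B₀ * (L : ℝ) ^ 3 * B₃ * ε₁ ∧
            ∀ X' : PBond (i.1.1.P i.1.2.2) 0 → Matrix (Fin 2) (Fin 2) ℂ, nMax19 i.1.1 i.1.2.1 i.1.2.2 U₀ X' < ε₄ →
              ((∀ b : PBond (i.1.1.P i.1.2.2) 0, (X' b).IsHermitian ∧ Matrix.trace (X' b) = 0) ∧ AvgCondPrint i.1.1 i.1.2.1 i.1.2.2 i.2.2.le V U₀ X' ∧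
                IsLandauPrint i.1.1 i.1.2.1 i.1.2.2 U₀ X' ∧ CritLPrint i.1.1 i.1.2.1 i.1.2.2 i.2.2.le V U₀ (expHermField X')) → X' = X)
    (hE : ∀ (L : ℕ), 1 < L → ∀ (B₃ : ℝ), 4 < B₃ →
      ∃ e₅ : ℝ, 0 < e₅ ∧ ∀ (i : Idx L) (e ε₁ : ℝ) (V : GaugeField (i.1.1.P i.1.2.1) 0 (Matrix.specialUnitaryGroup (Fin 2) ℂ))
        (U₀ U₁ : GaugeField (i.1.1.P i.1.2.2) 0 (Matrix.specialUnitaryGroup (Fin 2) ℂ)) (u : GaugeTransf (i.1.1.P i.1.2.2) 0 (Matrix.specialUnitaryGroup (Fin 2) ℂ)),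
        e ≤ e₅ → RegPr i.1.1 i.1.2.1 i.1.2.2 ((L : ℝ) ^ 3 * B₃ * ε₁) U₀ → CloseAvg i.1.1 i.1.2.1 i.1.2.2 i.2.2.le ((L : ℝ) ^ 3 * ε₁) V U₀ →
        CritLPrint i.1.1 i.1.2.1 i.1.2.2 i.2.2.le V U₀ U₁ → RestrictedPrint i.1.1 i.1.2.1 i.1.2.2 U₀ u →
        RegPr i.1.1 i.1.2.1 i.1.2.2 e (GaugeField.gaugeAct u (emb15 U₀ U₁)) →
        GaugeField.gaugeAct u (emb15 U₀ U₁) ∈ fibre i.1.1 ℰp i.1.2.1 i.1.2.2 i.2.2.le V →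
        IsCritR2 i.1.1 i.1.2.1 i.1.2.2 i.2.2.le V (GaugeField.gaugeAct u (emb15 U₀ U₁)) →
          GaugeField.gaugeAct u (emb15 U₀ U₁) ∈ regFibrePr i.1.1 i.1.2.1 i.1.2.2 i.2.2.le e V ∧
          IsMinOn (fun W : GaugeField (i.1.1.P i.1.2.2) 0 (Matrix.specialUnitaryGroup (Fin 2) ℂ) => wilsonAction4 W)
            (regFibrePr i.1.1 i.1.2.1 i.1.2.2 i.2.2.le e V) (GaugeField.gaugeAct u (emb15 U₀ U₁)))
    (h2 : ∀ L : ℕ, Odd L → 1 < L → Summit.QuantumFields.YangMills.Theorems.AlphaInputsT3ACv4RecChi L)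
    (hDisp : ∀ (L : ℕ), Odd L → 1 < L → ∀ (𝔠 : AlphaConsts L (suGroupModel 2).N) (a₀ a₁ : ℝ), 0 < a₀ → 0 < a₁ → 𝔠.B₃ * a₁ ≤ a₀ →
      ∃ a : ℝ, 0 < a ∧ a < 1 ∧ K1aLegRowsDisplayChiV4 L 𝔠 a₀ a₁ a) :
    FluctuationComparisonRegPrIntL :=
  regPrIntL_of_v8Leaves_recChiV4_k1aLegRowsDisplayChiV4_allL hV2 hA hC Summit.QuantumFields.YangMills.Theorems.PV3D.stub_PV3D hE h2 hDisp

end Summit.QuantumFields.YangMills.Theorems.InteriorExcision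

end
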